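import Mathlib
import HarnessLib

/-!
# Non-square descent — the FREENESS DESCENT of the cyclic Robert system (stub S2 core of the line card
# `nonsquare-descent`) for the seed crux `SignedMuSeedAtTwoPlus` stmt-BirchSwinnertonDyer-21438
# (parent Kμ⁺ `SignedMuVanishingAtTwoPlus` stmt-BirchSwinnertonDyer-20689, route ResidualThetaTransportAtTwo)

Cell `bsd-wall`, width seat `bsd-wall-rtt-p4-w2` g17 (`--supports`, closes nothing).  THEOREMS ONLY; BSD is not proved by this,
and nothing about any number field, unit group or elliptic unit is asserted: the statements are module algebra over an
arbitrary commutative ring.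

The crux idea `Cruxes/SignedMuSeedAtTwoPlus/Ideas/nonsquare-descent.md` (k2 g28) names as the «first ARITHMETIC lemma of the
line» the freeness descent

  `(𝓔 / 𝒪[G_m]·u)^{G_{m,n}} = 𝓔_n / 𝒪[G_n]·u_n`   (pure group cohomology: `H¹(G, free) = 0`, `(free)^G = norms`),

for a `ℤ₂`-free `𝒪[G_m]`-lattice `𝓔` with `G_{m,n}`-fixed points `𝓔_n` and a FREE cyclic sublattice `𝒪[G_m]·u` with exact norm
relation `N_{G_{m,n}} u = u_n` (`Lines/nonsquare-descent.md`, stub S2 `freenessDescentMuBound`, chain (2)–(3):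
`H¹(G_{m,n}, 𝓒'_m) = 0` and `(𝓒'_m)^G = 𝓒'_n` give `(B'_m)^G = B'_n` and `B'_n ↪ B'_m`).

Dictionary (nothing below depends on it).  Over the Iwasawa algebra `Λ' = 𝒪⟦T⟧` the group ring `𝒪[G_m]` is `Λ'/ω_m` with
`ω_m = (1+T)^{2^m} − 1`, the subgroup `G_{m,n}` is generated by `γ^{2ⁿ}`, its invariants on a `Λ'/ω_m`-module are the
`ω_n`-torsion (`ω_n = γ^{2ⁿ} − 1`), and its norm element is `ν = ν_{m,n} = ω_m / ω_n`.  So we work with a commutative ring `R`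
(`Λ'`), two elements `ω ν : R` (`ω_n`, `ν_{m,n}`; non-zero-divisors where cancellation is used — `Λ'` is a domain), an
`R`-module `E` killed by `ν * ω` (`𝓔_m^χ`, a `Λ'/ω_m`-module), an element `u : E` whose annihilator is EXACTLY `(ν * ω)`
(hypothesis `hu : ∀ r, r • u = 0 → ν * ω ∣ r` — this is «`𝒪[G_m]·u_m` is free of rank one», stub S1), a second module `En`
with an injective linear map `j : En →ₗ[R] E` whose range is the `ω`-torsion of `E` (`𝓔_n^χ ⊆ 𝓔_m^χ`: the units of `M_m`
fixed by `Gal(M_m/M_n)` are the units of `M_n`), and `un : En` with `j un = ν • u` (the EXACT norm relation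
`N_{M_m/M_n} u_m = u_n`, stub S1).  Then:

* §1 `mul_left_cancel_of_mem_nonZeroDivisors`, `dvd_of_mul_dvd_mul_left_of_mem_nonZeroDivisors` — cancellation.
* §2 **invariants of the free cyclic module are the multiples of the norm**: `mem_span_norm_of_smul_eq_zero`
  (`c ∈ R∙u`, `ω • c = 0` ⇒ `c ∈ R∙(ν • u)`), `smul_eq_zero_of_mem_span_norm`, `mem_span_and_smul_eq_zero_iff`,
  `span_inf_torsionBy_eq_span_norm` (`R∙u ⊓ E[ω] = R∙(ν•u)`, i.e. `(𝒪[G_m]u_m)^{G_{m,n}} = 𝒪[G_n]u_n`).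
* §3 **`H¹(G_{m,n}, 𝒪[G_m]u_m) = 0` in its working form**: `exists_torsion_sub_mem_span` (if `ω • e ∈ R∙u` then `e` is congruent
  modulo `R∙u` to an `ω`-torsion element) and `torsionBy_quotient_eq_map_mkQ` (the `ω`-torsion of `E ⧸ R∙u` is the image of the
  `ω`-torsion of `E`: «`(B'_m)^G` is covered by `𝓔_m^G = 𝓔_n`»).
* §4 **the level-`n` package**: `span_singleton_le_comap_of_eq_smul` (the norm relation makes `R∙un ≤ j⁻¹(R∙u)`, so `j` induces
  `φ : En ⧸ R∙un → E ⧸ R∙u`), `mapQ_injective_of_norm` (**`B'_n ↪ B'_m`**), `range_mapQ_eq_torsionBy_of_norm`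
  (**its image is exactly `(B'_m)^{G_{m,n}}`**), `nonempty_quotient_linearEquiv_torsionBy` (`B'_n ≃ (B'_m)^{G_{m,n}}`) and
  `natCard_torsionBy_quotient_eq` (`#(B'_m)^{G_{m,n}} = #B'_n`).

These are the two cohomological facts the card uses («because `𝓒'_m ≅ 𝒪[G_m]` is free with EXACT norm relations the quotients
descend perfectly, `(B'_m)^{G_{m,n}} = B'_n`, `H¹(G, 𝓒'_m) = 0`»), with the group cohomology unwound into `ω/ν`-cancellation
so that no `Rep`/`groupCohomology` object is needed by the line.  [folklore]
-/

set_option autoImplicit false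
-- the Theorems namespace of this sub repeats the summit name by design (D-0017 nested layout)
set_option linter.dupNamespace false

open scoped nonZeroDivisors

namespace Summit.BirchSwinnertonDyer.BirchSwinnertonDyer.Theorems.SignedMuAtTwo.NonsquareDescent

variable {R : Type*} [CommRing R] {E : Type*} [AddCommGroup E] [Module R E]

/-! ## §1 Cancellation by a non-zero-divisor -/

/-- Cancellation of a non-zero-divisor on the left. [folklore] -/
theorem mul_left_cancel_of_mem_nonZeroDivisors {ω a b : R} (hω : ω ∈ R⁰) (h : ω * a = ω * b) : a = b := by
  have h0 : ω * (a - b) = 0 := by rw [mul_sub, h, sub_self]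
  exact sub_eq_zero.mp ((mul_left_mem_nonZeroDivisors_eq_zero_iff hω).mp h0)

/-- `ω a ∣ ω b` with `ω` a non-zero-divisor gives `a ∣ b`. [folklore] -/
theorem dvd_of_mul_dvd_mul_left_of_mem_nonZeroDivisors {ω a b : R} (hω : ω ∈ R⁰) (h : ω * a ∣ ω * b) :
    a ∣ b := by
  obtain ⟨c, hc⟩ := h
  exact ⟨c, mul_left_cancel_of_mem_nonZeroDivisors hω (by rw [hc, mul_assoc])⟩

/-! ## §2 Invariants of the free cyclic module are the multiples of the norm -/

/-- For `u` with annihilator exactly `(ν ω)`: `r • u = 0 ↔ ν ω ∣ r`. [folklore] -/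
theorem smul_eq_zero_iff_dvd_of_ann {ν ω : R} {u : E} (hu0 : (ν * ω) • u = 0)
    (hu : ∀ r : R, r • u = 0 → ν * ω ∣ r) (r : R) : r • u = 0 ↔ ν * ω ∣ r := by
  refine ⟨hu r, fun ⟨s, hs⟩ => ?_⟩
  rw [hs, mul_comm, mul_smul, hu0, smul_zero]

/-- **`(𝒪[G_m]u)^{G_{m,n}} ⊆ 𝒪[G_m]·ν u`.**  If `c ∈ R∙u` is `ω`-torsion and the annihilator of `u` is exactly `(ν ω)`
(`ω` a non-zero-divisor), then `c` is a multiple of the norm `ν • u`. [folklore] -/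
theorem mem_span_norm_of_smul_eq_zero {ν ω : R} (hω : ω ∈ R⁰) {u : E}
    (hu : ∀ r : R, r • u = 0 → ν * ω ∣ r) {c : E} (hc : c ∈ Submodule.span R {u}) (hωc : ω • c = 0) :
    c ∈ Submodule.span R {ν • u} := by
  obtain ⟨r, rfl⟩ := Submodule.mem_span_singleton.mp hc
  rw [smul_smul] at hωc
  obtain ⟨s, hs⟩ := hu _ hωc
  have hr : r = ν * s :=
    mul_left_cancel_of_mem_nonZeroDivisors hω (by rw [hs]; ring)
  exact Submodule.mem_span_singleton.mpr ⟨s, by rw [hr, smul_smul, mul_comm]⟩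

/-- The norm `ν • u` (and all its multiples) is `ω`-torsion as soon as `ν ω` kills `u`. [folklore] -/
theorem smul_norm_smul_eq_zero {ν ω : R} {u : E} (hu0 : (ν * ω) • u = 0) (s : R) :
    ω • (s • ν • u) = 0 := by
  rw [smul_smul, smul_smul, show ω * s * ν = s * (ν * ω) by ring, mul_smul, hu0, smul_zero]

/-- **`𝒪[G_m]·ν u ⊆ (𝒪[G_m]u)^{G_{m,n}}`**: every element of `R∙(ν • u)` is `ω`-torsion. [folklore] -/
theorem smul_eq_zero_of_mem_span_norm {ν ω : R} {u : E} (hu0 : (ν * ω) • u = 0) {c : E}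
    (hc : c ∈ Submodule.span R {ν • u}) : ω • c = 0 := by
  obtain ⟨s, rfl⟩ := Submodule.mem_span_singleton.mp hc
  exact smul_norm_smul_eq_zero hu0 s

/-- `R∙(ν • u) ≤ R∙u`. [folklore] -/
theorem span_norm_le_span {ν : R} (u : E) : Submodule.span R {ν • u} ≤ Submodule.span R {u} := by
  rw [Submodule.span_singleton_le_iff_mem]
  exact Submodule.smul_mem _ _ (Submodule.mem_span_singleton_self u)

/-- **`(𝒪[G_m]u)^{G_{m,n}} = 𝒪[G_n]·u_n`** (elementwise): for `u` with annihilator exactly `(ν ω)`, an element lies in `R∙u`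
and is `ω`-torsion iff it is a multiple of the norm `ν • u`. [folklore] -/
theorem mem_span_and_smul_eq_zero_iff {ν ω : R} (hω : ω ∈ R⁰) {u : E} (hu0 : (ν * ω) • u = 0)
    (hu : ∀ r : R, r • u = 0 → ν * ω ∣ r) (c : E) :
    (c ∈ Submodule.span R {u} ∧ ω • c = 0) ↔ c ∈ Submodule.span R {ν • u} :=
  ⟨fun h => mem_span_norm_of_smul_eq_zero hω hu h.1 h.2,
    fun h => ⟨span_norm_le_span u h, smul_eq_zero_of_mem_span_norm hu0 h⟩⟩

/-- **`(𝒪[G_m]u)^{G_{m,n}} = 𝒪[G_n]·u_n`** (submodule form): `R∙u ⊓ E[ω] = R∙(ν • u)`. [folklore] -/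
theorem span_inf_torsionBy_eq_span_norm {ν ω : R} (hω : ω ∈ R⁰) {u : E} (hu0 : (ν * ω) • u = 0)
    (hu : ∀ r : R, r • u = 0 → ν * ω ∣ r) :
    Submodule.span R {u} ⊓ Submodule.torsionBy R E ω = Submodule.span R {ν • u} := by
  ext c
  rw [Submodule.mem_inf, Submodule.mem_torsionBy_iff]
  exact mem_span_and_smul_eq_zero_iff hω hu0 hu c

/-! ## §3 `H¹(G_{m,n}, 𝒪[G_m]u) = 0`: `ω`-torsion classes modulo `R∙u` lift to `ω`-torsion elements -/

/-- **`H¹ = 0` for the free cyclic module, working form.**  If `E` is killed by `ν ω`, `ν` is a non-zero-divisor and the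
annihilator of `u` is exactly `(ν ω)`, then every `e` with `ω • e ∈ R∙u` is congruent modulo `R∙u` to an `ω`-torsion element.
(Write `ω e = f u`; then `ν f u = ν ω e = 0`, so `ν ω ∣ ν f`, `f = ω g`, and `e − g u` is `ω`-torsion.) [folklore] -/
theorem exists_torsion_sub_mem_span {ν ω : R} (hν : ν ∈ R⁰) (hE : ∀ x : E, (ν * ω) • x = 0) {u : E}
    (hu : ∀ r : R, r • u = 0 → ν * ω ∣ r) {e : E} (he : ω • e ∈ Submodule.span R {u}) :
    ∃ e' : E, ω • e' = 0 ∧ e - e' ∈ Submodule.span R {u} := by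
  obtain ⟨f, hf⟩ := Submodule.mem_span_singleton.mp he
  have h1 : (ν * f) • u = 0 := by rw [mul_smul, hf, smul_smul, hE]
  obtain ⟨g, hg⟩ := hu _ h1
  have hfg : f = ω * g :=
    mul_left_cancel_of_mem_nonZeroDivisors hν (by rw [hg, mul_assoc])
  refine ⟨e - g • u, ?_, ?_⟩
  · rw [smul_sub, smul_smul, ← hfg, hf, sub_self]
  · rw [sub_sub_cancel]
    exact Submodule.smul_mem _ _ (Submodule.mem_span_singleton_self u)

/-- **`(B'_m)^{G_{m,n}}` is covered by `𝓔_m^{G_{m,n}}`**: the `ω`-torsion of `E ⧸ R∙u` is the image of the `ω`-torsion of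
`E`. [folklore] -/
theorem torsionBy_quotient_eq_map_mkQ {ν ω : R} (hν : ν ∈ R⁰) (hE : ∀ x : E, (ν * ω) • x = 0) {u : E}
    (hu : ∀ r : R, r • u = 0 → ν * ω ∣ r) :
    Submodule.torsionBy R (E ⧸ Submodule.span R {u}) ω
      = (Submodule.torsionBy R E ω).map (Submodule.span R {u}).mkQ := by
  ext x
  constructor
  · intro hx
    rw [Submodule.mem_torsionBy_iff] at hx
    obtain ⟨e, rfl⟩ := Submodule.mkQ_surjective (Submodule.span R {u}) x
    rw [Submodule.mkQ_apply, ← Submodule.Quotient.mk_smul, Submodule.Quotient.mk_eq_zero] at hx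
    obtain ⟨e', h1, h2⟩ := exists_torsion_sub_mem_span hν hE hu hx
    refine ⟨e', (Submodule.mem_torsionBy_iff _ _).mpr h1, ?_⟩
    rw [Submodule.mkQ_apply, Submodule.mkQ_apply, eq_comm, Submodule.Quotient.eq]
    exact h2
  · rintro ⟨e, he, rfl⟩
    rw [SetLike.mem_coe, Submodule.mem_torsionBy_iff] at he
    rw [Submodule.mem_torsionBy_iff, Submodule.mkQ_apply, ← Submodule.Quotient.mk_smul, he,
      Submodule.Quotient.mk_zero]

/-! ## §4 The level-`n` package: `B'_n ↪ B'_m` with image `(B'_m)^{G_{m,n}}` -/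

section LevelN

variable {En : Type*} [AddCommGroup En] [Module R En]

/-- The exact norm relation `j un = ν • u` makes `R∙un ≤ j⁻¹(R∙u)`, so that `j` induces a map of quotients
`En ⧸ R∙un → E ⧸ R∙u` (`Submodule.mapQ`). [folklore] -/
theorem span_singleton_le_comap_of_eq_smul (j : En →ₗ[R] E) {u : E} {ν : R} {un : En}
    (hun : j un = ν • u) :
    Submodule.span R {un} ≤ (Submodule.span R {u}).comap j := by
  rw [Submodule.span_singleton_le_iff_mem, Submodule.mem_comap, hun]
  exact Submodule.smul_mem _ _ (Submodule.mem_span_singleton_self u)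

/-- **`B'_n ↪ B'_m`.**  With `j : En → E` injective and landing in the `ω`-torsion, `u` with annihilator exactly `(ν ω)`
(`ω` a non-zero-divisor) and `j un = ν • u`, the induced map `En ⧸ R∙un → E ⧸ R∙u` is injective.
(An element of `j(En) ∩ R∙u` is `ω`-torsion in `R∙u`, hence a multiple of `ν • u = j un` by §2.) [folklore] -/
theorem mapQ_injective_of_norm {ν ω : R} (hω : ω ∈ R⁰) {u : E}
    (hu : ∀ r : R, r • u = 0 → ν * ω ∣ r) (j : En →ₗ[R] E) (hj : Function.Injective j)
    (hjω : ∀ x : En, ω • j x = 0) {un : En} (hun : j un = ν • u)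
    (h : Submodule.span R {un} ≤ (Submodule.span R {u}).comap j) :
    Function.Injective (Submodule.mapQ (Submodule.span R {un}) (Submodule.span R {u}) j h) := by
  rw [← LinearMap.ker_eq_bot, Submodule.eq_bot_iff]
  intro x hx
  obtain ⟨e, rfl⟩ := Submodule.mkQ_surjective (Submodule.span R {un}) x
  rw [LinearMap.mem_ker, Submodule.mkQ_apply, Submodule.mapQ_apply, Submodule.Quotient.mk_eq_zero] at hx
  have hmem : j e ∈ Submodule.span R {ν • u} := mem_span_norm_of_smul_eq_zero hω hu hx (hjω e)
  obtain ⟨s, hs⟩ := Submodule.mem_span_singleton.mp hmem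
  have he : e = s • un := hj (by rw [map_smul, hun, hs])
  rw [Submodule.mkQ_apply, Submodule.Quotient.mk_eq_zero, he]
  exact Submodule.smul_mem _ _ (Submodule.mem_span_singleton_self un)

/-- **The image of `B'_n → B'_m` is exactly `(B'_m)^{G_{m,n}}`.**  With `E` killed by `ν ω` (`ν` a non-zero-divisor), `u`
with annihilator exactly `(ν ω)`, `j : En → E` whose range is the `ω`-torsion of `E`, and `j un = ν • u`, the range of the
induced map `En ⧸ R∙un → E ⧸ R∙u` is the `ω`-torsion of `E ⧸ R∙u`. [folklore] -/
theorem range_mapQ_eq_torsionBy_of_norm {ν ω : R} (hν : ν ∈ R⁰) (hE : ∀ x : E, (ν * ω) • x = 0) {u : E}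
    (hu : ∀ r : R, r • u = 0 → ν * ω ∣ r) (j : En →ₗ[R] E)
    (hjω : ∀ x : En, ω • j x = 0) (hjr : ∀ e : E, ω • e = 0 → e ∈ LinearMap.range j) {un : En}
    (h : Submodule.span R {un} ≤ (Submodule.span R {u}).comap j) :
    LinearMap.range (Submodule.mapQ (Submodule.span R {un}) (Submodule.span R {u}) j h)
      = Submodule.torsionBy R (E ⧸ Submodule.span R {u}) ω := by
  ext y
  constructor
  · rintro ⟨x, rfl⟩
    obtain ⟨e, rfl⟩ := Submodule.mkQ_surjective (Submodule.span R {un}) x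
    rw [Submodule.mem_torsionBy_iff, Submodule.mkQ_apply, Submodule.mapQ_apply,
      ← Submodule.Quotient.mk_smul, hjω, Submodule.Quotient.mk_zero]
  · intro hy
    rw [torsionBy_quotient_eq_map_mkQ hν hE hu] at hy
    obtain ⟨e, he, rfl⟩ := hy
    rw [SetLike.mem_coe, Submodule.mem_torsionBy_iff] at he
    obtain ⟨x, hx⟩ := hjr e he
    refine ⟨Submodule.Quotient.mk x, ?_⟩
    rw [Submodule.mapQ_apply, hx, Submodule.mkQ_apply]

/-- **`B'_n ≃ (B'_m)^{G_{m,n}}`** — the freeness descent of the card as ONE linear equivalence: under the hypotheses of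
`mapQ_injective_of_norm` and `range_mapQ_eq_torsionBy_of_norm`, `En ⧸ R∙un` is linearly equivalent to the `ω`-torsion
of `E ⧸ R∙u`. [folklore] -/
theorem nonempty_quotient_linearEquiv_torsionBy {ν ω : R} (hω : ω ∈ R⁰) (hν : ν ∈ R⁰)
    (hE : ∀ x : E, (ν * ω) • x = 0) {u : E} (hu : ∀ r : R, r • u = 0 → ν * ω ∣ r)
    (j : En →ₗ[R] E) (hj : Function.Injective j) (hjω : ∀ x : En, ω • j x = 0)
    (hjr : ∀ e : E, ω • e = 0 → e ∈ LinearMap.range j) {un : En} (hun : j un = ν • u) :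
    Nonempty ((En ⧸ Submodule.span R {un}) ≃ₗ[R]
      Submodule.torsionBy R (E ⧸ Submodule.span R {u}) ω) := by
  have h := span_singleton_le_comap_of_eq_smul j hun
  refine ⟨(LinearEquiv.ofInjective _ (mapQ_injective_of_norm hω hu j hj hjω hun h)).trans
    (LinearEquiv.ofEq _ _ (range_mapQ_eq_torsionBy_of_norm hν hE hu j hjω hjr h))⟩

/-- **`#(B'_m)^{G_{m,n}} = #B'_n`** (cardinal form of the freeness descent, the shape used in the card's index bookkeeping
`#B'_n ≤ #F^χ · #(Q'/ω_n Q')`). [folklore] -/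
theorem natCard_torsionBy_quotient_eq {ν ω : R} (hω : ω ∈ R⁰) (hν : ν ∈ R⁰)
    (hE : ∀ x : E, (ν * ω) • x = 0) {u : E} (hu : ∀ r : R, r • u = 0 → ν * ω ∣ r)
    (j : En →ₗ[R] E) (hj : Function.Injective j) (hjω : ∀ x : En, ω • j x = 0)
    (hjr : ∀ e : E, ω • e = 0 → e ∈ LinearMap.range j) {un : En} (hun : j un = ν • u) :
    Nat.card (Submodule.torsionBy R (E ⧸ Submodule.span R {u}) ω)
      = Nat.card (En ⧸ Submodule.span R {un}) := by
  obtain ⟨φ⟩ := nonempty_quotient_linearEquiv_torsionBy hω hν hE hu j hj hjω hjr hun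
  exact (Nat.card_congr φ.toEquiv).symm

end LevelN

end Summit.BirchSwinnertonDyer.BirchSwinnertonDyer.Theorems.SignedMuAtTwo.NonsquareDescent
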